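import Summits.MatrixMultiplication.OmegaCensus.MetaCyclic

/-!
# ω-census, family (b3): conjecture C9 on the METACYCLIC / FROBENIUS FAMILY `ℤ/N ⋊_u ℤ/q` — boxes reduce to forbidden differences on `9 × ℤ/N`

HONEST FRAMING (pub-omega census; verbatim): lottery ticket; floor = certified bounds/negative ranges.
Census BOOKKEEPING (conjecture C9 of the cell; pub-omega stpp-1 gen 20).  For the kernel type `MetaCyc N q u = ℤ/N ⋊_u ℤ/q`
(`MetaCyclic.lean`: elements `a^i b^t`, `(i,t)(j,s) = (i + u^t j, t + s)`, group when `u^q = 1`) this file reduces the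
independence of a cell set in a `3 × 3` box `G × Y × W` to a finite PATTERN condition on `(Fin 3 × Fin 3) × ZMod N`:
* a box `D : ABox N q` lists the exponents `y_i = a^{α i} b^{a i}`, `w_j = a^{β j} b^{b j}` of the three `Y`- and the three
  `W`-elements; write `σ(c) = a i + b j` for the `b`-exponent sum of the column `c = (i, j)`;
* the cell of column `c` at *coordinate* `A : ZMod N` and *level* `t : ZMod q` is `(a^{u^{-σ(c)} A} b^t, y_i, w_j)` (`ABox.cell`);
* KEY IDENTITY (`ABox.cellWord_cell`): two such cells interact (`cellWord = 1`, i.e. `x x'⁻¹ · y y'⁻¹ · w w'⁻¹ = 1`) only if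
  `t' = t + σ(c) − σ(c')` AND their coordinates differ by the constant
  `ABox.dd D u c c' = u^{a_i + b_{j'}} (α_{i'} − β_j) + u^{a_i + b_j} β_{j'} − u^{a_{i'} + b_{j'}} α_i`
  (the `ℤ/N`-part of `w' w⁻¹ y' y⁻¹`, transported by `u^{σ(c)}`) — so the conflict graph of the box is `q` disjoint copies of ONE
  'forbidden-difference graph' `Γ(D)` on `9 × ℤ/N` (column pair `(c, c')` joined along the two translations `dd c c'`, `−dd c' c`);
* hence (`ABox.not_boxUseful_of_pattern`) a pattern `T ⊆ (Fin 3 × Fin 3) × ZMod N` with no ordered pair at a forbidden difference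
  (`PatIndep`) lifts to an independent cell set of `#T · q` cells (`cellSet`, `card_cellSet`), and `9N ≤ 5·#T` makes
  `MetaCyc N q u` not box-useful; `exists_indep_of_pattern` is the witness form, with `_of_surjective_` / `_of_injective_` lifts.
Consequence for the census: `α(ℤ/N ⋊_u ℤ/q; 3,3) = q · max_D MIS(Γ(D))` is a problem on `9N` (not `9Nq`) vertices — exact values
`α(C₇ ⋊ C₃) = 42`, `α(C₁₃ ⋊ C₃) = 84` by complete sweeps of the seat (engine level), kernel witnesses in the companion file.
For `q = 2`, `u = −1` this is the dihedral fibre picture of `DihedralUniform.lean`.  Nothing here is progress on `ω`.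
-/

namespace Summit.MatrixMultiplication.OmegaCensus

open Finset ProductBoxBound

namespace MetaCyc

variable {N q : ℕ} {u : ZMod N}

/-- `u^s · u^t = u^{s+t}` on exponents in `ZMod q` (`u^q = 1`). [folklore] -/
theorem act_mul_act [NeZero q] (hu : u ^ q = 1) (s t : ZMod q) : act u s * act u t = act u (s + t) :=
  (act_add hu s t).symm

/-- `u^s · (u^t · x) = u^{s+t} · x`. [folklore] -/
theorem act_mul_act_mul [NeZero q] (hu : u ^ q = 1) (s t : ZMod q) (x : ZMod N) :
    act u s * (act u t * x) = act u (s + t) * x := by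
  rw [← mul_assoc, act_mul_act hu]

/-- Box data for `MetaCyc N q u`: `y_i = a^{α i} b^{a i}`, `w_j = a^{β j} b^{b j}`. [folklore] -/
structure ABox (N q : ℕ) where
  /-- `a`-exponents of `y₀, y₁, y₂` -/
  α : Fin 3 → ZMod N
  /-- `b`-exponents of `y₀, y₁, y₂` -/
  a : Fin 3 → ZMod q
  /-- `a`-exponents of `w₀, w₁, w₂` -/
  β : Fin 3 → ZMod N
  /-- `b`-exponents of `w₀, w₁, w₂` -/
  b : Fin 3 → ZMod q

namespace ABox

variable (D : ABox N q) (u)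

/-- The `Y`-element `y_i = a^{α i} b^{a i}`. [folklore] -/
def yEl (i : Fin 3) : MetaCyc N q u := ⟨D.α i, D.a i⟩

/-- The `W`-element `w_j = a^{β j} b^{b j}`. [folklore] -/
def wEl (j : Fin 3) : MetaCyc N q u := ⟨D.β j, D.b j⟩

/-- The `b`-exponent sum `σ(c) = a i + b j` of the column `c = (i, j)`. [folklore] -/
def sig (c : Fin 3 × Fin 3) : ZMod q := D.a c.1 + D.b c.2

/-- The forbidden coordinate difference from column `c = (i,j)` to column `c' = (i',j')`:
`u^{a_i + b_{j'}} (α_{i'} − β_j) + u^{a_i + b_j} β_{j'} − u^{a_{i'} + b_{j'}} α_i`. [folklore] -/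
def dd (c c' : Fin 3 × Fin 3) : ZMod N :=
  act u (D.a c.1 + D.b c'.2) * (D.α c'.1 - D.β c.2) + act u (D.a c.1 + D.b c.2) * D.β c'.2
    - act u (D.a c'.1 + D.b c'.2) * D.α c.1

/-- The cell of column `c = (i,j)` at coordinate `A` and level `t`: `(a^{u^{-σ(c)} A} b^t, y_i, w_j)`. [folklore] -/
def cell (c : Fin 3 × Fin 3) (A : ZMod N) (t : ZMod q) : MetaCyc N q u × MetaCyc N q u × MetaCyc N q u :=
  (⟨act u (-D.sig c) * A, t⟩, D.yEl u c.1, D.wEl u c.2)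

/-- The `ℤ/q`-part of a cell word is the signed sum of the `b`-exponents. [folklore] -/
theorem cellWord_t [NeZero q] [Fact (u ^ q = 1)] (x y w x' y' w' : MetaCyc N q u) :
    (cellWord (x, y, w) (x', y', w')).t = x.t - x'.t + (y.t - y'.t) + (w.t - w'.t) := by
  simp only [cellWord, MetaCyc.mul_def, MetaCyc.inv_def]; ring

/-- The `ℤ/N`-part of a cell word, powers of `u` collected. [folklore] -/
theorem cellWord_i [NeZero q] [Fact (u ^ q = 1)] (x y w x' y' w' : MetaCyc N q u) :
    (cellWord (x, y, w) (x', y', w')).i =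
      x.i - act u (x.t + -x'.t) * x'.i
        + act u (x.t + -x'.t) * (y.i - act u (y.t + -y'.t) * y'.i)
        + act u (x.t + -x'.t + (y.t + -y'.t)) * (w.i - act u (w.t + -w'.t) * w'.i) := by
  have hu : u ^ q = 1 := Fact.out
  simp only [cellWord, MetaCyc.mul_def, MetaCyc.inv_def, mul_neg, act_mul_act_mul hu]
  ring

/-- **Key identity.** Two cells interact only if their levels differ by `σ(c) − σ(c')` and their coordinates by `dd c c'`.
[folklore] -/
theorem cellWord_cell [NeZero q] [Fact (u ^ q = 1)] {c c' : Fin 3 × Fin 3} {A A' : ZMod N} {t t' : ZMod q}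
    (hw : cellWord (D.cell u c A t) (D.cell u c' A' t') = 1) :
    t' = t + D.sig c - D.sig c' ∧ A - A' = D.dd u c c' := by
  have hu : u ^ q = 1 := Fact.out
  have ht := congrArg MetaCyc.t hw
  have hi := congrArg MetaCyc.i hw
  rw [cell, cell, cellWord_t] at ht
  rw [cell, cell, cellWord_i] at hi
  simp only [yEl, wEl, MetaCyc.one_def, sig] at ht hi ⊢
  have et : t' = t + (D.a c.1 + D.b c.2) - (D.a c'.1 + D.b c'.2) := by linear_combination -ht
  refine ⟨et, ?_⟩
  subst et
  have h3 := congrArg (fun z => act u (D.a c.1 + D.b c.2) * z) hi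
  simp only [mul_zero, mul_add, mul_sub, act_mul_act_mul hu] at h3
  simp only [dd]
  ring_nf at h3 ⊢
  simp only [act_zero, one_mul] at h3
  linear_combination h3

/-- The injectivity data of a nondegenerate box: the three `Y`-elements and the three `W`-elements are distinct. [folklore] -/
structure Nondeg : Prop where
  /-- the three `Y`-elements are distinct -/
  y_inj : Function.Injective (D.yEl u)
  /-- the three `W`-elements are distinct -/
  w_inj : Function.Injective (D.wEl u)

/-- Nondegeneracy is decidable (it is a statement about six explicit exponent pairs). [folklore] -/
theorem nondeg_of (hy : ∀ i i' : Fin 3, (D.α i, D.a i) = (D.α i', D.a i') → i = i')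
    (hw : ∀ j j' : Fin 3, (D.β j, D.b j) = (D.β j', D.b j') → j = j') : D.Nondeg u :=
  ⟨fun i i' e => hy i i' (by simp only [yEl, MetaCyc.mk.injEq] at e; exact Prod.ext e.1 e.2),
    fun j j' e => hw j j' (by simp only [wEl, MetaCyc.mk.injEq] at e; exact Prod.ext e.1 e.2)⟩

/-- `u^t` is a unit (`u^q = 1`). [folklore] -/
theorem act_mul_cancel [NeZero q] (hu : u ^ q = 1) (s : ZMod q) {A A' : ZMod N} (h : act u s * A = act u s * A') :
    A = A' := by
  have := congrArg (fun z => act u (-s) * z) h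
  simpa only [act_mul_act_mul hu, neg_add_cancel, act_zero, one_mul] using this

/-- Cells determine their data (for a nondegenerate box). [folklore] -/
theorem cell_inj [NeZero q] [Fact (u ^ q = 1)] (hD : D.Nondeg u) {c c' : Fin 3 × Fin 3} {A A' : ZMod N}
    {t t' : ZMod q} (e : D.cell u c A t = D.cell u c' A' t') : c = c' ∧ A = A' ∧ t = t' := by
  simp only [cell, Prod.mk.injEq, MetaCyc.mk.injEq] at e
  obtain ⟨⟨e1, e2⟩, ey, ew⟩ := e
  have hc : c = c' := Prod.ext (hD.y_inj ey) (hD.w_inj ew)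
  subst hc
  exact ⟨rfl, act_mul_cancel u Fact.out _ e1, e2⟩

/-- A pattern `T ⊆ (Fin 3 × Fin 3) × ZMod N` (column, coordinate) is *independent* when no ordered pair of distinct entries
sits at a forbidden difference. [folklore] -/
def PatIndep (T : Finset ((Fin 3 × Fin 3) × ZMod N)) : Prop :=
  ∀ x ∈ T, ∀ y ∈ T, x ≠ y → x.2 - y.2 ≠ D.dd u x.1 y.1

/-- Pattern independence is decidable (finite quantifiers over `T`, equality in `ZMod N`). [folklore] -/
instance (T : Finset ((Fin 3 × Fin 3) × ZMod N)) [NeZero N] : Decidable (D.PatIndep u T) := by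
  unfold PatIndep; infer_instance

variable [NeZero N] [NeZero q] [Fact (u ^ q = 1)]

/-- The cell set of a pattern: over every entry `(c, A)` the `q` cells of column `c` at coordinate `A` (all levels). [folklore] -/
def cellSet (T : Finset ((Fin 3 × Fin 3) × ZMod N)) : Finset (MetaCyc N q u × MetaCyc N q u × MetaCyc N q u) :=
  T.biUnion fun x => (univ : Finset (ZMod q)).image fun t => D.cell u x.1 x.2 t

omit [NeZero N] [Fact (u ^ q = 1)] in
/-- Membership in the cell set. [folklore] -/
theorem mem_cellSet {T : Finset ((Fin 3 × Fin 3) × ZMod N)} {P : MetaCyc N q u × MetaCyc N q u × MetaCyc N q u} :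
    P ∈ D.cellSet u T ↔ ∃ x ∈ T, ∃ t : ZMod q, P = D.cell u x.1 x.2 t := by
  constructor
  · intro hP
    obtain ⟨x, hx, hP⟩ := mem_biUnion.1 hP
    obtain ⟨t, -, ht⟩ := mem_image.1 hP
    exact ⟨x, hx, t, ht.symm⟩
  · rintro ⟨x, hx, t, rfl⟩
    exact mem_biUnion.2 ⟨x, hx, mem_image.2 ⟨t, mem_univ _, rfl⟩⟩

omit [Fact (u ^ q = 1)] in
/-- The cell set lies in the box `G × Y × W`, `Y = {y_i}`, `W = {w_j}`. [folklore] -/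
theorem cellSet_subset (T : Finset ((Fin 3 × Fin 3) × ZMod N)) :
    D.cellSet u T ⊆ univ ×ˢ ((univ.image (D.yEl u)) ×ˢ (univ.image (D.wEl u))) := by
  intro P hP
  obtain ⟨x, -, t, rfl⟩ := (D.mem_cellSet u).1 hP
  simp only [cell, mem_product, mem_univ, true_and, mem_image]
  exact ⟨⟨x.1.1, rfl⟩, ⟨x.1.2, rfl⟩⟩

omit [NeZero N] in
/-- The cell set has `#T · q` cells (nondegenerate box). [folklore] -/
theorem card_cellSet (hD : D.Nondeg u) (T : Finset ((Fin 3 × Fin 3) × ZMod N)) : #(D.cellSet u T) = #T * q := by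
  have hinj : ∀ x : (Fin 3 × Fin 3) × ZMod N, Function.Injective (fun t : ZMod q => D.cell u x.1 x.2 t) := by
    intro x t t' e
    exact (D.cell_inj u hD e).2.2
  rw [cellSet, card_biUnion]
  · have : ∀ x ∈ T, #((univ : Finset (ZMod q)).image fun t => D.cell u x.1 x.2 t) = q := fun x _ => by
      rw [card_image_of_injective _ (hinj x), card_univ, ZMod.card]
    rw [sum_congr rfl this, sum_const, smul_eq_mul]
  · intro x _ y _ hxy
    rw [Function.onFun, disjoint_left]
    intro P hPx hPy
    obtain ⟨t, -, rfl⟩ := mem_image.1 hPx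
    obtain ⟨t', -, e⟩ := mem_image.1 hPy
    obtain ⟨hc, hA, -⟩ := D.cell_inj u hD e.symm
    exact hxy (Prod.ext hc hA)

omit [NeZero N] in
/-- An independent pattern gives an independent cell set. [folklore] -/
theorem cellSet_indep {T : Finset ((Fin 3 × Fin 3) × ZMod N)} (hT : D.PatIndep u T) :
    ∀ P ∈ D.cellSet u T, ∀ P' ∈ D.cellSet u T, P ≠ P' → cellWord P P' ≠ 1 := by
  intro P hP P' hP' hne hw
  obtain ⟨x, hx, t, rfl⟩ := (D.mem_cellSet u).1 hP
  obtain ⟨y, hy, t', rfl⟩ := (D.mem_cellSet u).1 hP'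
  obtain ⟨e1, e2⟩ := D.cellWord_cell u hw
  by_cases hxy : x = y
  · subst hxy
    apply hne
    have h1 : t' = t := by rw [e1]; ring
    rw [h1]
  · exact hT x hx y hy hxy e2

/-- **Witness form of the pattern lemma**: an independent pattern `T` for a nondegenerate box gives a `3 × 3` box of
`MetaCyc N q u` with an independent cell set of exactly `#T · q` cells. [folklore] -/
theorem exists_indep_of_pattern (hD : D.Nondeg u) {T : Finset ((Fin 3 × Fin 3) × ZMod N)} (hT : D.PatIndep u T) :
    ∃ (Y W : Finset (MetaCyc N q u)) (I : Finset (MetaCyc N q u × MetaCyc N q u × MetaCyc N q u)),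
      #Y = 3 ∧ #W = 3 ∧ I ⊆ univ ×ˢ (Y ×ˢ W) ∧ (∀ P ∈ I, ∀ P' ∈ I, P ≠ P' → cellWord P P' ≠ 1) ∧ #I = #T * q :=
  ⟨univ.image (D.yEl u), univ.image (D.wEl u), D.cellSet u T,
    by rw [card_image_of_injective _ hD.y_inj, card_univ, Fintype.card_fin],
    by rw [card_image_of_injective _ hD.w_inj, card_univ, Fintype.card_fin],
    D.cellSet_subset u T, D.cellSet_indep u hT, D.card_cellSet u hD T⟩

/-- **The pattern lemma**: an independent pattern with `9N ≤ 5·#T` makes `MetaCyc N q u` not box-useful. [folklore] -/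
theorem not_boxUseful_of_pattern (hD : D.Nondeg u) {T : Finset ((Fin 3 × Fin 3) × ZMod N)} (hT : D.PatIndep u T)
    (hbig : 9 * N ≤ 5 * #T) : ¬ BoxUseful (MetaCyc N q u) := by
  obtain ⟨Y, W, I, hY, hW, hI, hind, hcard⟩ := D.exists_indep_of_pattern u hD hT
  refine not_boxUseful_of_indep hY hW hI hind ?_
  rw [hcard, MetaCyc.card]
  calc 9 * (N * q) = (9 * N) * q := by ring
    _ ≤ (5 * #T) * q := Nat.mul_le_mul_right _ hbig
    _ = 5 * (#T * q) := by ring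

/-- Along a surjection `G ↠ MetaCyc N q u`, an independent pattern with `9N ≤ 5·#T` makes `G` not box-useful. [folklore] -/
theorem not_boxUseful_of_surjective_of_pattern (hD : D.Nondeg u) {T : Finset ((Fin 3 × Fin 3) × ZMod N)}
    (hT : D.PatIndep u T) (hbig : 9 * N ≤ 5 * #T) {G : Type*} [Group G] [Fintype G] [DecidableEq G]
    (f : G →* MetaCyc N q u) (hf : Function.Surjective f) : ¬ BoxUseful G := by
  obtain ⟨Y, W, I, hY, hW, hI, hind, hcard⟩ := D.exists_indep_of_pattern u hD hT
  refine not_boxUseful_of_surjective f hf hY hW hI hind ?_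
  rw [hcard, MetaCyc.card]
  calc 9 * (N * q) = (9 * N) * q := by ring
    _ ≤ (5 * #T) * q := Nat.mul_le_mul_right _ hbig
    _ = 5 * (#T * q) := by ring

/-- Along an injection `MetaCyc N q u ↪ G`, an independent pattern with `9N ≤ 5·#T` makes `G` not box-useful. [folklore] -/
theorem not_boxUseful_of_injective_of_pattern (hD : D.Nondeg u) {T : Finset ((Fin 3 × Fin 3) × ZMod N)}
    (hT : D.PatIndep u T) (hbig : 9 * N ≤ 5 * #T) {G : Type*} [Group G] [Fintype G] [DecidableEq G]
    (f : MetaCyc N q u →* G) (hf : Function.Injective f) : ¬ BoxUseful G := by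
  obtain ⟨Y, W, I, hY, hW, hI, hind, hcard⟩ := D.exists_indep_of_pattern u hD hT
  refine not_boxUseful_of_injective f hf hY hW hI hind ?_
  rw [hcard, MetaCyc.card]
  calc 9 * (N * q) = (9 * N) * q := by ring
    _ ≤ (5 * #T) * q := Nat.mul_le_mul_right _ hbig
    _ = 5 * (#T * q) := by ring

end ABox

end MetaCyc

end Summit.MatrixMultiplication.OmegaCensus
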